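import Literature.AlgebraicGeometry.GroupSchemes.AffineGroupSchemeIsoSpec
import Literature.AlgebraicGeometry.GroupSchemes.AffineGroupSchemeBialgHom
import Literature.AlgebraicGeometry.GroupSchemes.GroupSchemeKernel
import HarnessLib

/-!
# The coordinate ring of the kernel of a homomorphism of affine group schemes: `Γ(Ker φ) ≅ Γ(G₁) ⧸ φ^*(Γ(G₂)⁺)·Γ(G₁)`

Layer `Literature/AlgebraicGeometry/GroupSchemes`, namespace `Literature.AlgebraicGeometry.GroupSchemes.AffineGroupScheme` (continues ★
`GroupSchemeKernel` — `ker φ = G₁ ×_{G₂,e} Spec R`, `kerι`, `kerLift` —, ★ `HopfIdealOfClosedSubgroup` — the ideal `ker Γ(i)` of a closed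
subscheme `i : K ↪ G`, `K ≅ Spec (Γ(G) ⧸ ker Γ(i))`, points criterion —, ★ `AffineGroupSchemeIsoSpec` (`comap_one_eq : Γ(e) = η ∘ ε`) and ★
`AffineGroupSchemeBialgHom` (`ptEquiv_comp`)).  THEOREMS ONLY (no definition, no instance, no notation, no named fact, no `sorry`).  Cell
`hodgecm-mathlib` (D-0151), programme P6 «MOD», organ (K-alg) of B-p04 (g37) = the scheme half of the RANK CLAUSE of rider (a) (★
`CartierDualAnnihilator` p845459: `rk H^⊥ · rk H = rk G`), whose algebra half is A-p17 (g25)'s ★ `RingTheory/HopfAlgebra/FreeOverSubbialgebra`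
(`dim A · dim (B ⧸ A⁺B) = dim B`).  Count-neutral Mathlib-side capital: HC_CM is proved only modulo the printed citations until rung 0 closes;
nothing here bears on it.

THE PRINT ([Waterhouse1979] §2.1 p. 14: «the kernel of `G → H` is represented by `A ⊗_B k = A ⧸ (I_B) A`, `I_B` the augmentation ideal of
`B = k[H]`»; [GortzWedhorn2020] Definition 4.45 (2): `Ker f = G ×_{H,e} S`; [Tate1997FiniteFlatGroupSchemes] (3.7)).  For ANY morphism
`φ : G₁ ⟶ G₂` of affine `R`-schemes into an AFFINE group object `G₂` of `SchemeOver R = Over (Spec R)` (no group structure on `G₁` and no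
`IsMonHom φ` are needed: `Ker φ` is the fibre of `φ` over the unit section), write `Γ(φ) = Alg.comap φ : Γ(G₂) → Γ(G₁)`,
`ε₂ : Γ(G₂) → R` for the counit (★ `Alg.instHopfAlgebra`), and `J := (ker ε₂).map Γ(φ)` — the ideal of `Γ(G₁)` generated by `φ^*` of the
augmentation ideal.  THEN:

* §1 `Ker φ ↪ G₁` is a closed immersion and `Ker φ` is affine (`isClosedImmersion_kerι_left_of_isAffine`, `isAffine_ker_left`; ★
  `isClosedImmersion_kerι_left_of_isSeparated`, an affine `G₂ → Spec R` being separated);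
* §2 `Γ(ι) ∘ Γ(φ) = η ∘ ε₂` (`comap_kerι_comp_comap`), whence `J ≤ ker Γ(ι)` (`map_ker_counit_le_ker_appTop_kerι`);
* §3 the algebra map of the unit point is `η ∘ ε` (`ptEquiv_one`); the test point `quotIncl G₁ J : Spec (Γ(G₁) ⧸ J) ↪ G₁` is killed by `φ`
  (`quotIncl_comp_eq_one`), so it factors through `Ker φ` (`exists_comp_kerι_eq_quotIncl`), whence `ker Γ(ι) ≤ J`;
* §4 HEAD **`ker_appTop_kerι_eq : ker Γ(ι : Ker φ → G₁) = (ker ε₂).map Γ(φ)`** — THE IDEAL OF THE KERNEL IS GENERATED BY `φ^*(Γ(G₂)⁺)` —, and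
  its corollaries **`exists_algEquiv_quotient_alg_ker : Γ(G₁) ⧸ J ≃ₐ[R] Γ(Ker φ)`** (class of `y` ↦ `Γ(ι)(y)`),
  **`exists_iso_ker_comp_quotIncl_eq : Ker φ ≅ Spec (Γ(G₁) ⧸ J)` over `G₁`**, `finrank_alg_ker_eq : rk_R Γ(Ker φ) = rk_R (Γ(G₁) ⧸ J)`, and the
  points criterion `exists_comp_kerι_eq_iff_map_ker_counit_le` (a point of `G₁` factors through `Ker φ` iff its algebra map kills `J`).

## References
* [Waterhouse1979] W. C. Waterhouse, *Introduction to Affine Group Schemes*, GTM 66 (1979) — §2.1 (kernels, closed subgroups and Hopf ideals), p. 14.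
* [GortzWedhorn2020] U. Görtz, T. Wedhorn, *Algebraic Geometry I: Schemes*, 2nd ed. (2020) — Definition 4.45 (2), p. 117.
* [GortzWedhorn2023] U. Görtz, T. Wedhorn, *Algebraic Geometry II* (2023) — (27.1.1), §(27.2) (pp. 606–607).
-/

set_option autoImplicit false

-- Mathlib's `Over`/`Scheme` APIs are stated across semireducible wrappers (as in the ★ `GroupSchemes/*` files).
set_option backward.isDefEq.respectTransparency false

universe u

open CategoryTheory CategoryTheory.Limits AlgebraicGeometry MonoidalCategory CartesianMonoidalCategory

noncomputable section

namespace Literature.AlgebraicGeometry.GroupSchemes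

namespace AffineGroupScheme

open scoped MonObj

open Literature.AlgebraicGeometry.Motives Literature.NumberTheory.DiophantineGeometry GroupSchemeKernel

variable {R : Type u} [CommRing R]

/-! ## §1 `Ker φ ↪ G₁` is a closed immersion; `Ker φ` is affine -/

section Closed

variable {G₁ G₂ : SchemeOver R} [GrpObj G₂] [IsAffine G₂.left] (φ : G₁ ⟶ G₂)

/-- **`Ker φ ↪ G₁` is a closed immersion** for affine `G₂` (the unit section of the affine, hence separated, `G₂ → Spec R` is a closed
immersion; ★ `isClosedImmersion_kerι_left_of_isSeparated`). [cite: GortzWedhorn2020, Definition 4.45 (2), p. 117] -/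
theorem isClosedImmersion_kerι_left_of_isAffine : IsClosedImmersion (kerι φ).left :=
  isClosedImmersion_kerι_left_of_isSeparated φ

/-- **`Ker φ` is affine** (a closed subscheme of the affine `G₁`). [cite: Waterhouse1979, §2.1 p. 14] -/
theorem isAffine_ker_left [IsAffine G₁.left] : IsAffine (ker φ).left :=
  haveI := isClosedImmersion_kerι_left_of_isAffine φ
  isAffine_left_of_isClosedImmersion (kerι φ)

end Closed

/-! ## §2 `Γ(ι) ∘ Γ(φ) = η ∘ ε₂`, so `φ^*(Γ(G₂)⁺)` dies on `Ker φ` -/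

section Ideal

variable {G₁ G₂ : SchemeOver R} [GrpObj G₂] [IsAffine G₂.left] (φ : G₁ ⟶ G₂)

/-- **The algebra map of the trivial morphism `1 : T → G` is `η ∘ ε`** (`1 = (T → Spec R) ≫ e` and ★ `comap_one_eq : Γ(e) = η ∘ ε`).
[cite: GortzWedhorn2023, §(27.2) (27.2.1) (pp. 606–607)] -/
theorem comap_one_hom (T : SchemeOver R) :
    Alg.comap (1 : T ⟶ G₂) = (Algebra.ofId R (Alg T)).comp (Bialgebra.counitAlgHom R (Alg G₂)) := by
  rw [Hom.one_def, Alg.comap_comp, comap_one_eq, ← AlgHom.comp_assoc, Algebra.comp_ofId]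

/-- **`Γ(ι) ∘ Γ(φ) = η ∘ ε₂`** for the inclusion `ι : Ker φ ↪ G₁` (`ι ≫ φ = 1`, ★ `kerι_comp`). [cite: Waterhouse1979, §2.1 p. 14] -/
theorem comap_kerι_comp_comap :
    (Alg.comap (kerι φ)).comp (Alg.comap φ) = (Algebra.ofId R (Alg (ker φ))).comp (Bialgebra.counitAlgHom R (Alg G₂)) := by
  rw [← Alg.comap_comp, kerι_comp, comap_one_hom]

/-- `Γ(ι)(Γ(φ)(a)) = ε₂(a) · 1`. [cite: Waterhouse1979, §2.1 p. 14] -/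
theorem comap_kerι_comap_apply (a : Alg G₂) :
    Alg.comap (kerι φ) (Alg.comap φ a) = algebraMap R (Alg (ker φ)) (Bialgebra.counitAlgHom R (Alg G₂) a) := by
  rw [← AlgHom.comp_apply, comap_kerι_comp_comap]
  rfl

/-- **`J := (ker ε₂).map Γ(φ) ≤ ker Γ(ι)`**: the pull-back of the augmentation ideal of `Γ(G₂)` dies on `Ker φ`. [cite: Waterhouse1979, §2.1 p. 14] -/
theorem map_ker_counit_le_ker_appTop_kerι :
    (RingHom.ker (Bialgebra.counitAlgHom R (Alg G₂))).map (Alg.comap φ) ≤ (RingHom.ker (kerι φ).left.appTop.hom : Ideal (Alg G₁)) := by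
  rw [Ideal.map_le_iff_le_comap]
  intro a ha
  rw [RingHom.mem_ker] at ha
  rw [Ideal.mem_comap, RingHom.mem_ker]
  change Alg.comap (kerι φ) (Alg.comap φ a) = 0
  rw [comap_kerι_comap_apply, ha, map_zero]

/-! ## §3 The test point `Spec (Γ(G₁) ⧸ J) ↪ G₁` is killed by `φ`, so it factors through `Ker φ` -/

variable {R' : Type u} [CommRing R'] [Algebra R R']

/-- **The algebra map of the unit point `1 ∈ G(Spec R′)` is `η ∘ ε`** (★ `groupLaw_one`, ★ `CorepGroupLaw.one_eq`, ★ `counitAlgHom_alg_eq`).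
[cite: GortzWedhorn2023, §(27.2) (27.2.1) (pp. 606–607)] -/
theorem ptEquiv_one : ptEquiv G₂ R' (1 : specOver R R' ⟶ G₂) = (Algebra.ofId R R').comp (Bialgebra.counitAlgHom R (Alg G₂)) := by
  rw [← groupLaw_one, CorepGroupLaw.one_eq, counitAlgHom_alg_eq]

/-- **`ε₂` splits `Γ(G₂) = R·1 ⊕ ker ε₂`**: `a - ε₂(a)·1 ∈ ker ε₂`. [cite: Waterhouse1979, §2.1 p. 14] -/
theorem sub_algebraMap_counit_mem_ker (a : Alg G₂) :
    a - algebraMap R (Alg G₂) (Bialgebra.counitAlgHom R (Alg G₂) a) ∈ RingHom.ker (Bialgebra.counitAlgHom R (Alg G₂)) := by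
  rw [RingHom.mem_ker, map_sub, AlgHom.commutes, Algebra.algebraMap_self_apply, sub_self]

/-- **`(Γ(G₁) ↠ Γ(G₁) ⧸ J) ∘ Γ(φ) = η ∘ ε₂`**: modulo `J`, `Γ(φ)` is the trivial character. [cite: Waterhouse1979, §2.1 p. 14] -/
theorem mkₐ_comp_comap_eq :
    (Ideal.Quotient.mkₐ R ((RingHom.ker (Bialgebra.counitAlgHom R (Alg G₂))).map (Alg.comap φ))).comp (Alg.comap φ) =
      (Algebra.ofId R _).comp (Bialgebra.counitAlgHom R (Alg G₂)) := by
  ext a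
  rw [AlgHom.comp_apply, AlgHom.comp_apply, Ideal.Quotient.mkₐ_eq_mk]
  have h : a = (a - algebraMap R (Alg G₂) (Bialgebra.counitAlgHom R (Alg G₂) a)) +
      algebraMap R (Alg G₂) (Bialgebra.counitAlgHom R (Alg G₂) a) := (sub_add_cancel a _).symm
  conv_lhs => rw [h]
  rw [map_add, map_add, AlgHom.commutes, Ideal.Quotient.eq_zero_iff_mem.mpr
    (Ideal.mem_map_of_mem _ (sub_algebraMap_counit_mem_ker a)), zero_add]
  rfl

variable [IsAffine G₁.left]

/-- **The test point `Spec (Γ(G₁) ⧸ J) ↪ G₁` is killed by `φ`**: `quotIncl G₁ J ≫ φ = 1` (both sides have algebra map `η ∘ ε₂`).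
[cite: Waterhouse1979, §2.1 p. 14] -/
theorem quotIncl_comp_eq_one :
    quotIncl G₁ ((RingHom.ker (Bialgebra.counitAlgHom R (Alg G₂))).map (Alg.comap φ)) ≫ φ = 1 := by
  apply (ptEquiv G₂ _).injective
  rw [ptEquiv_comp, ptEquiv_quotIncl, mkₐ_comp_comap_eq, ptEquiv_one]

/-- Hence the test point factors through `Ker φ` (★ `kerLift`). [cite: GortzWedhorn2020, Definition 4.45 (2), p. 117] -/
theorem exists_comp_kerι_eq_quotIncl :
    ∃ v : specOver R (Alg G₁ ⧸ (RingHom.ker (Bialgebra.counitAlgHom R (Alg G₂))).map (Alg.comap φ)) ⟶ ker φ,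
      v ≫ kerι φ = quotIncl G₁ ((RingHom.ker (Bialgebra.counitAlgHom R (Alg G₂))).map (Alg.comap φ)) :=
  ⟨kerLift _ (quotIncl_comp_eq_one φ), kerLift_ι _ _⟩

/-- **`ker Γ(ι) ≤ J`**: the ideal of `Ker φ` is contained in `φ^*(Γ(G₂)⁺)·Γ(G₁)` (points criterion ★ `exists_comp_eq_iff_ker_appTop_le` at the
test point, whose algebra map `Γ(G₁) ↠ Γ(G₁) ⧸ J` has kernel `J`). [cite: Waterhouse1979, §2.1 p. 14] -/
theorem ker_appTop_kerι_le_map_ker_counit :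
    (RingHom.ker (kerι φ).left.appTop.hom : Ideal (Alg G₁)) ≤ (RingHom.ker (Bialgebra.counitAlgHom R (Alg G₂))).map (Alg.comap φ) := by
  haveI := isClosedImmersion_kerι_left_of_isAffine φ
  haveI := isAffine_ker_left φ
  intro a ha
  have h := ((exists_comp_eq_iff_ker_appTop_le (kerι φ) _).mp (exists_comp_kerι_eq_quotIncl φ)) ha
  rw [RingHom.mem_ker, AlgHom.toRingHom_eq_coe, AlgHom.coe_toRingHom, ptEquiv_quotIncl, Ideal.Quotient.mkₐ_eq_mk,
    Ideal.Quotient.eq_zero_iff_mem] at h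
  exact h

/-! ## §4 HEAD: the ideal of `Ker φ` is `φ^*(Γ(G₂)⁺)·Γ(G₁)`; `Γ(Ker φ) ≅ Γ(G₁) ⧸ J`; `Ker φ ≅ Spec (Γ(G₁) ⧸ J)` -/

/-- **HEAD — THE IDEAL OF THE KERNEL: `ker Γ(ι : Ker φ ↪ G₁) = (ker ε₂).map Γ(φ)`** ([Waterhouse1979] §2.1: «`Ker (G → H)` is represented by
`A ⧸ I_B A`»). [cite: Waterhouse1979, §2.1 p. 14] [cite: GortzWedhorn2020, Definition 4.45 (2), p. 117] -/
theorem ker_appTop_kerι_eq :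
    (RingHom.ker (kerι φ).left.appTop.hom : Ideal (Alg G₁)) = (RingHom.ker (Bialgebra.counitAlgHom R (Alg G₂))).map (Alg.comap φ) :=
  le_antisymm (ker_appTop_kerι_le_map_ker_counit φ) (map_ker_counit_le_ker_appTop_kerι φ)

/-- **`Γ(G₁) ⧸ φ^*(Γ(G₂)⁺)·Γ(G₁) ≃ₐ[R] Γ(Ker φ)`**, the class of `y` going to `Γ(ι)(y)` (★ `exists_algEquiv_quotient_ker_appTop`).
[cite: Waterhouse1979, §2.1 p. 14] -/
theorem exists_algEquiv_quotient_alg_ker :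
    ∃ e : (Alg G₁ ⧸ (RingHom.ker (Bialgebra.counitAlgHom R (Alg G₂))).map (Alg.comap φ)) ≃ₐ[R] Alg (ker φ),
      ∀ y : Alg G₁, e (Ideal.Quotient.mk _ y) = (kerι φ).left.appTop.hom y := by
  haveI := isClosedImmersion_kerι_left_of_isAffine φ
  haveI := isAffine_ker_left φ
  obtain ⟨e, he⟩ := exists_algEquiv_quotient_ker_appTop (kerι φ)
  refine ⟨(Ideal.quotientEquivAlgOfEq R (ker_appTop_kerι_eq φ)).symm.trans e, fun y => ?_⟩
  rw [AlgEquiv.trans_apply, ← he y]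
  rfl

/-- **`Ker φ ≅ Spec (Γ(G₁) ⧸ φ^*(Γ(G₂)⁺)·Γ(G₁))` OVER `G₁`**: an `R`-isomorphism `e` with `e.hom ≫ quotIncl G₁ J = ι`
(★ `exists_iso_comp_quotIncl_ker_appTop_eq`). [cite: Waterhouse1979, §2.1 p. 14] [cite: GortzWedhorn2020, Definition 4.45 (2), p. 117] -/
theorem exists_iso_ker_comp_quotIncl_eq :
    ∃ e : ker φ ≅ specOver R (Alg G₁ ⧸ (RingHom.ker (Bialgebra.counitAlgHom R (Alg G₂))).map (Alg.comap φ)),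
      e.hom ≫ quotIncl G₁ ((RingHom.ker (Bialgebra.counitAlgHom R (Alg G₂))).map (Alg.comap φ)) = kerι φ := by
  haveI := isClosedImmersion_kerι_left_of_isAffine φ
  haveI := isAffine_ker_left φ
  have h := exists_iso_comp_quotIncl_ker_appTop_eq (kerι φ)
  rw [ker_appTop_kerι_eq φ] at h
  exact h

/-- **Rank bookkeeping: `rk_R Γ(Ker φ) = rk_R (Γ(G₁) ⧸ φ^*(Γ(G₂)⁺)·Γ(G₁))`.** [cite: Waterhouse1979, §2.1 p. 14] -/
theorem finrank_alg_ker_eq :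
    Module.finrank R (Alg (ker φ)) =
      Module.finrank R (Alg G₁ ⧸ (RingHom.ker (Bialgebra.counitAlgHom R (Alg G₂))).map (Alg.comap φ)) := by
  obtain ⟨e, -⟩ := exists_algEquiv_quotient_alg_ker φ
  exact e.toLinearEquiv.finrank_eq.symm

/-- **Points criterion**: a point `u : Spec R′ → G₁` factors through `Ker φ` iff its algebra map kills `φ^*(Γ(G₂)⁺)` (equivalently, iff
`u ≫ φ = 1`, ★ `kerLift`). [cite: Waterhouse1979, §2.1 p. 14] -/
theorem exists_comp_kerι_eq_iff_map_ker_counit_le (u : specOver R R' ⟶ G₁) :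
    (∃ v : specOver R R' ⟶ ker φ, v ≫ kerι φ = u) ↔
      (RingHom.ker (Bialgebra.counitAlgHom R (Alg G₂))).map (Alg.comap φ) ≤ RingHom.ker (ptEquiv G₁ R' u).toRingHom := by
  haveI := isClosedImmersion_kerι_left_of_isAffine φ
  haveI := isAffine_ker_left φ
  rw [← ker_appTop_kerι_eq φ]
  exact exists_comp_eq_iff_ker_appTop_le (kerι φ) u

end Ideal

end AffineGroupScheme

end Literature.AlgebraicGeometry.GroupSchemes

end
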